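import Literature.AlgebraicTopology.SingularHomology.MayerVietorisExactness
import Literature.AlgebraicTopology.SingularHomology.CollapseMap
import HarnessLib

/-!
# The Mayer–Vietoris five-lemma comparison

Topic `Literature/AlgebraicTopology/SingularHomology`. The standard comparison principle for the
Mayer–Vietoris sequences of a map of open-interior covers (A. Hatcher, *Algebraic Topology*
(2002), §2.2 p. 150 "the Mayer–Vietoris sequence is natural", with the five lemma, §2.1
p. 129): for `f : X → Y` with `f(U) ⊆ U'`, `f(V) ⊆ V'`, `X = int U ∪ int V`,
`Y = int U' ∪ int V'`, the ladder

`Hₖ₊₁(U ∩ V) → Hₖ₊₁(U) ⊕ Hₖ₊₁(V) → Hₖ₊₁(X) →δ Hₖ(U ∩ V) → Hₖ(U) ⊕ Hₖ(V)`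
`      ↓a            ↓b            ↓c         ↓d           ↓e`
`Hₖ₊₁(U'∩ V') → Hₖ₊₁(U') ⊕ Hₖ₊₁(V') → Hₖ₊₁(Y) →δ Hₖ(U'∩ V') → Hₖ(U') ⊕ Hₖ(V')`

commutes and has exact rows, so that `c = f_*` is an isomorphism on `Hₖ₊₁` as soon as `a` is onto,
`b`, `d` are isomorphisms and `e` is injective. This is the tool behind every "is a homology
isomorphism by a Mayer–Vietoris argument" — e.g. C. McA. Gordon, *Knots, homology spheres, and
contractible 4-manifolds*, Topology 14 (1975), and Akbulut–Ruberman (2016), Lemma 2.3 ("That `X`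
is a homology cobordism is standard [Gordon]": replacing the tubes `Lᵢ × D² × I` of `M × I` by
concordance complements with the same homology does not change the homology). The tree had the
four-lemma special case with vanishing `Hₖ₊₁` of the four pieces
(`Literature.Topology.FourManifolds.isIso_singularHomology_map_succ_of_mayerVietoris`,
`HomotopySpheresSumHomology.lean`) and several further special cases
(`mayerVietoris.isIso_map_right_of_isZero`, …); here is the general statement.

* `isIso_of_five_lemma` — the five lemma in `ModuleCat` by a diagram chase, with exactly the
  complex/exactness hypotheses the Mayer–Vietoris rows supply;
* `mayerVietoris.ψ_naturality`, `mayerVietoris.φ_naturality` — the two easy squares (the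
  third is the tree's `mayerVietoris.δ_naturality_holds`);
* `isIso_singularHomology_map_succ_of_mayerVietoris_five` — **the comparison in degree `k + 1`**
  under `Epi a`, `IsIso b` (both summands), `IsIso d`, `Mono e` (both summands);
* `isIso_singularHomology_map_succ_of_forall_isIso`, `isIso_singularHomology_map_of_forall_isIso`
  — **if `f|U`, `f|V`, `f|U ∩ V` are homology isomorphisms in all degrees then so is `f`** (in
  positive degrees; in all degrees when `X`, `Y` are path connected).

Everything here is proved; no named facts are introduced.

## References

* A. Hatcher, *Algebraic Topology*, CUP (2002), §2.1 p. 129 (five lemma), §2.2 pp. 149–150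
  (Mayer–Vietoris sequence and its naturality). [HatcherAT2002]
* C. McA. Gordon, *Knots, homology spheres, and contractible 4-manifolds*, Topology 14 (1975),
  151–172. [Gordon1975]
-/

noncomputable section

open CategoryTheory Limits Set Function

namespace Literature.AlgebraicTopology.SingularHomology

universe u v w

/-! ### The five lemma in `ModuleCat` -/

section FiveLemma

variable {A : Type v} [Ring A] {P₁ P₂ P₃ P₄ P₅ Q₁ Q₂ Q₃ Q₄ Q₅ : ModuleCat.{w} A}

/-- **The five lemma** (Hatcher, *Algebraic Topology* (2002), §2.1 p. 129) in `ModuleCat`, by the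
usual diagram chase, with the hypotheses in the form supplied by Mayer–Vietoris ladders: a
commutative ladder `P₁ → P₂ → P₃ → P₄ → P₅` over `Q₁ → Q₂ → Q₃ → Q₄ → Q₅` with vertical maps
`a, b, c, d, e`, the top row a complex at `P₂` and exact at `P₃`, `P₄`, the bottom row exact at
`Q₂`, `Q₃` and a complex at `Q₄`; if `a` is onto, `b` and `d` are isomorphisms and `e` is
injective, then `c` is an isomorphism. [cite: HatcherAT2002, §2.1 p. 129 (five lemma)] -/
theorem isIso_of_five_lemma {f₁ : P₁ ⟶ P₂} {f₂ : P₂ ⟶ P₃} {f₃ : P₃ ⟶ P₄} {f₄ : P₄ ⟶ P₅}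
    {g₁ : Q₁ ⟶ Q₂} {g₂ : Q₂ ⟶ Q₃} {g₃ : Q₃ ⟶ Q₄} {g₄ : Q₄ ⟶ Q₅}
    (a : P₁ ⟶ Q₁) (b : P₂ ⟶ Q₂) (c : P₃ ⟶ Q₃) (d : P₄ ⟶ Q₄) (e : P₅ ⟶ Q₅)
    (sq₁ : f₁ ≫ b = a ≫ g₁) (sq₂ : f₂ ≫ c = b ≫ g₂) (sq₃ : f₃ ≫ d = c ≫ g₃)
    (sq₄ : f₄ ≫ e = d ≫ g₄)
    (w₁₂ : f₁ ≫ f₂ = 0) (w₂₃ : f₂ ≫ f₃ = 0) (ex₂₃ : (ShortComplex.mk f₂ f₃ w₂₃).Exact)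
    (w₃₄ : f₃ ≫ f₄ = 0) (ex₃₄ : (ShortComplex.mk f₃ f₄ w₃₄).Exact)
    (w₁₂' : g₁ ≫ g₂ = 0) (ex₁₂' : (ShortComplex.mk g₁ g₂ w₁₂').Exact)
    (w₂₃' : g₂ ≫ g₃ = 0) (ex₂₃' : (ShortComplex.mk g₂ g₃ w₂₃').Exact) (w₃₄' : g₃ ≫ g₄ = 0)
    [Epi a] [IsIso b] [IsIso d] [Mono e] : IsIso c := by
  have ha : Surjective a := (ModuleCat.epi_iff_surjective a).mp inferInstance
  have hbi : Injective b := (ModuleCat.mono_iff_injective b).mp inferInstance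
  have hbs : Surjective b := (ModuleCat.epi_iff_surjective b).mp inferInstance
  have hdi : Injective d := (ModuleCat.mono_iff_injective d).mp inferInstance
  have hds : Surjective d := (ModuleCat.epi_iff_surjective d).mp inferInstance
  have he : Injective e := (ModuleCat.mono_iff_injective e).mp inferInstance
  -- pointwise forms of the squares and complexes
  have sq₁' : ∀ x, b (f₁ x) = g₁ (a x) := fun x => by
    rw [← ModuleCat.comp_apply, sq₁, ModuleCat.comp_apply]
  have sq₂' : ∀ x, c (f₂ x) = g₂ (b x) := fun x => by
    rw [← ModuleCat.comp_apply, sq₂, ModuleCat.comp_apply]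
  have sq₃' : ∀ x, d (f₃ x) = g₃ (c x) := fun x => by
    rw [← ModuleCat.comp_apply, sq₃, ModuleCat.comp_apply]
  have sq₄' : ∀ x, e (f₄ x) = g₄ (d x) := fun x => by
    rw [← ModuleCat.comp_apply, sq₄, ModuleCat.comp_apply]
  have w₁₂p : ∀ x, f₂ (f₁ x) = 0 := fun x => by
    rw [← ModuleCat.comp_apply, w₁₂]; rfl
  have w₃₄p' : ∀ x, g₄ (g₃ x) = 0 := fun x => by
    rw [← ModuleCat.comp_apply, w₃₄']; rfl
  have ex₂₃p := (ShortComplex.moduleCat_exact_iff _).mp ex₂₃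
  have ex₃₄p := (ShortComplex.moduleCat_exact_iff _).mp ex₃₄
  have ex₁₂p' := (ShortComplex.moduleCat_exact_iff _).mp ex₁₂'
  have ex₂₃p' := (ShortComplex.moduleCat_exact_iff _).mp ex₂₃'
  -- injectivity of `c`
  have hker : ∀ x, c x = 0 → x = 0 := by
    intro x hx
    have h3 : f₃ x = 0 := by
      apply hdi
      rw [sq₃', hx, map_zero, map_zero]
    obtain ⟨y, hy⟩ := ex₂₃p x h3
    change f₂ y = x at hy
    have h2 : g₂ (b y) = 0 := by rw [← sq₂', hy, hx]
    obtain ⟨z', hz'⟩ := ex₁₂p' (b y) h2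
    change g₁ z' = b y at hz'
    obtain ⟨z, rfl⟩ := ha z'
    have hyz : y = f₁ z := hbi (by rw [sq₁', hz'])
    rw [← hy, hyz, w₁₂p]
  have hmono : Mono c := by
    rw [ModuleCat.mono_iff_injective]
    intro x y hxy
    have h : c (x - y) = 0 := by rw [map_sub, hxy, sub_self]
    exact sub_eq_zero.mp (hker _ h)
  -- surjectivity of `c`
  have hepi : Epi c := by
    rw [ModuleCat.epi_iff_surjective]
    intro x'
    obtain ⟨w, hw⟩ := hds (g₃ x')
    have h4 : f₄ w = 0 := by
      apply he
      rw [sq₄', hw, w₃₄p', map_zero]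
    obtain ⟨x, hx⟩ := ex₃₄p w h4
    change f₃ x = w at hx
    have h3 : g₃ (x' - c x) = 0 := by
      rw [map_sub, ← sq₃', hx, hw, sub_self]
    obtain ⟨y', hy'⟩ := ex₂₃p' _ h3
    change g₂ y' = x' - c x at hy'
    obtain ⟨y, rfl⟩ := hbs y'
    refine ⟨x + f₂ y, ?_⟩
    rw [map_add, sq₂', hy', add_sub_cancel]
  exact isIso_of_mono_of_epi c

end FiveLemma

/-! ### The Mayer–Vietoris comparison -/

section Comparison

variable (R : Type v) [CommRing R] (M : Type v) [AddCommGroup M] [Module R M]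
variable {X Y : Type u} [TopologicalSpace X] [TopologicalSpace Y]

/-- The inclusion of a piece commutes with `f` and its restriction:
`incl_{U'} ∘ f|U = f ∘ incl_U`. [folklore] -/
theorem subsetIncl_comp_subsetRestrict_eq (f : C(X, Y)) {U : Set X} {U' : Set Y}
    (hU : MapsTo f U U') : (subsetIncl U').comp (subsetRestrict f hU) = f.comp (subsetIncl U) := by
  ext x
  rfl

/-- **Naturality of `ψ`**: `ψ ≫ f_* = ((f|U)_* ⊕ (f|V)_*) ≫ ψ'`. [cite: HatcherAT2002, §2.2 p. 150] -/
theorem mayerVietoris.ψ_naturality (f : C(X, Y)) {U V : Set X} {U' V' : Set Y}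
    (hU : MapsTo f U U') (hV : MapsTo f V V') (n : ℕ) :
    mayerVietoris.ψ R M U V n ≫ singularHomology.map R M f n =
      biprod.map (singularHomology.map R M (subsetRestrict f hU) n)
        (singularHomology.map R M (subsetRestrict f hV) n) ≫ mayerVietoris.ψ R M U' V' n := by
  apply biprod.hom_ext'
  · rw [mayerVietoris.ψ, mayerVietoris.ψ, biprod.inl_desc_assoc, biprod.inl_map_assoc,
      biprod.inl_desc, ← singularHomology.map_comp, ← singularHomology.map_comp,
      subsetIncl_comp_subsetRestrict_eq]
  · rw [mayerVietoris.ψ, mayerVietoris.ψ, biprod.inr_desc_assoc, biprod.inr_map_assoc,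
      biprod.inr_desc, ← singularHomology.map_comp, ← singularHomology.map_comp,
      subsetIncl_comp_subsetRestrict_eq]

/-- **Naturality of `φ`**: `φ ≫ ((f|U)_* ⊕ (f|V)_*) = (f|U ∩ V)_* ≫ φ'`. [cite: HatcherAT2002, §2.2 p. 150] -/
theorem mayerVietoris.φ_naturality (f : C(X, Y)) {U V : Set X} {U' V' : Set Y}
    (hU : MapsTo f U U') (hV : MapsTo f V V') (n : ℕ) :
    mayerVietoris.φ R M U V n ≫ biprod.map (singularHomology.map R M (subsetRestrict f hU) n)
        (singularHomology.map R M (subsetRestrict f hV) n) =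
      singularHomology.map R M (subsetRestrict f (hU.inter_inter hV)) n ≫
        mayerVietoris.φ R M U' V' n := by
  apply biprod.hom_ext
  · simp only [mayerVietoris.φ, Category.assoc, biprod.map_fst, biprod.lift_fst_assoc,
      biprod.lift_fst]
    rw [← singularHomology.map_comp, ← singularHomology.map_comp]
    rfl
  · simp only [mayerVietoris.φ, Category.assoc, biprod.map_snd, biprod.lift_snd_assoc,
      biprod.lift_snd, Preadditive.neg_comp, Preadditive.comp_neg, neg_inj]
    rw [← singularHomology.map_comp, ← singularHomology.map_comp]
    rfl

/-- **The Mayer–Vietoris five-lemma comparison in degree `k + 1`** (Hatcher (2002), §2.2 p. 150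
with §2.1 p. 129). Let `f : X → Y` map the open-interior cover `X = int U ∪ int V` into the
open-interior cover `Y = int U' ∪ int V'` (`f(U) ⊆ U'`, `f(V) ⊆ V'`). If
`(f|U ∩ V)_* : Hₖ₊₁(U ∩ V) → Hₖ₊₁(U' ∩ V')` is onto, `(f|U)_*`, `(f|V)_*` are isomorphisms on
`Hₖ₊₁`, `(f|U ∩ V)_*` is an isomorphism on `Hₖ` and `(f|U)_*`, `(f|V)_*` are injective on `Hₖ`,
then `f_* : Hₖ₊₁(X) → Hₖ₊₁(Y)` is an isomorphism. (Rows: the tree's Mayer–Vietoris sequences,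
exact by `mayerVietoris.exact₁/₂/₃_holds`; squares: `φ_naturality`, `ψ_naturality`,
`δ_naturality_holds`; then `isIso_of_five_lemma`.) [cite: HatcherAT2002, §2.2 p. 150] -/
theorem isIso_singularHomology_map_succ_of_mayerVietoris_five (f : C(X, Y)) {U V : Set X}
    {U' V' : Set Y} (hU : MapsTo f U U') (hV : MapsTo f V V')
    (hc : interior U ∪ interior V = univ) (hc' : interior U' ∪ interior V' = univ) (k : ℕ)
    [Epi (singularHomology.map R M (subsetRestrict f (hU.inter_inter hV)) (k + 1))]
    [IsIso (singularHomology.map R M (subsetRestrict f hU) (k + 1))]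
    [IsIso (singularHomology.map R M (subsetRestrict f hV) (k + 1))]
    [IsIso (singularHomology.map R M (subsetRestrict f (hU.inter_inter hV)) k)]
    [Mono (singularHomology.map R M (subsetRestrict f hU) k)]
    [Mono (singularHomology.map R M (subsetRestrict f hV) k)] :
    IsIso (singularHomology.map R M f (k + 1)) := by
  have hexc := relativeSingularHomology.isIso_map_of_interior_union_interior_holds R M X
  have hexc' := relativeSingularHomology.isIso_map_of_interior_union_interior_holds R M Y
  -- `b = (f|U)_* ⊕ (f|V)_*` on `Hₖ₊₁` is an isomorphism (mono and epi)
  haveI : IsIso (biprod.map (singularHomology.map R M (subsetRestrict f hU) (k + 1))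
      (singularHomology.map R M (subsetRestrict f hV) (k + 1))) := isIso_of_mono_of_epi _
  exact isIso_of_five_lemma
    (f₁ := mayerVietoris.φ R M U V (k + 1)) (f₂ := mayerVietoris.ψ R M U V (k + 1))
    (f₃ := mayerVietoris.δ R M U V hexc hc k) (f₄ := mayerVietoris.φ R M U V k)
    (g₁ := mayerVietoris.φ R M U' V' (k + 1)) (g₂ := mayerVietoris.ψ R M U' V' (k + 1))
    (g₃ := mayerVietoris.δ R M U' V' hexc' hc' k) (g₄ := mayerVietoris.φ R M U' V' k)
    (singularHomology.map R M (subsetRestrict f (hU.inter_inter hV)) (k + 1))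
    (biprod.map (singularHomology.map R M (subsetRestrict f hU) (k + 1))
      (singularHomology.map R M (subsetRestrict f hV) (k + 1)))
    (singularHomology.map R M f (k + 1))
    (singularHomology.map R M (subsetRestrict f (hU.inter_inter hV)) k)
    (biprod.map (singularHomology.map R M (subsetRestrict f hU) k)
      (singularHomology.map R M (subsetRestrict f hV) k))
    (mayerVietoris.φ_naturality R M f hU hV (k + 1)) (mayerVietoris.ψ_naturality R M f hU hV (k + 1))
    (mayerVietoris.δ_naturality_holds R M hexc hexc' f hU hV hc hc' k)
    (mayerVietoris.φ_naturality R M f hU hV k)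
    (mayerVietoris.φ_comp_ψ R M U V (k + 1)) (mayerVietoris.ψ_comp_δ R M U V hexc hc k)
    (mayerVietoris.exact₂_holds R M U V hexc hc k) (mayerVietoris.δ_comp_φ R M U V hexc hc k)
    (mayerVietoris.exact₃_holds R M U V hexc hc k)
    (mayerVietoris.φ_comp_ψ R M U' V' (k + 1)) (mayerVietoris.exact₁_holds R M U' V' hc' (k + 1))
    (mayerVietoris.ψ_comp_δ R M U' V' hexc' hc' k) (mayerVietoris.exact₂_holds R M U' V' hexc' hc' k)
    (mayerVietoris.δ_comp_φ R M U' V' hexc' hc' k)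

/-- **Pieces and intersection homology isomorphisms ⇒ homology isomorphism in positive degrees.**
If `f|U`, `f|V` and `f|U ∩ V` induce isomorphisms on `Hⱼ` for all `j`, then
`f_* : Hₖ₊₁(X) → Hₖ₊₁(Y)` is an isomorphism for every `k` (the usual form of "homology
isomorphism by Mayer–Vietoris", e.g. Gordon (1975); Akbulut–Ruberman (2016), Lemma 2.3).
[cite: HatcherAT2002, §2.2 p. 150] -/
theorem isIso_singularHomology_map_succ_of_forall_isIso (f : C(X, Y)) {U V : Set X}
    {U' V' : Set Y} (hU : MapsTo f U U') (hV : MapsTo f V V')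
    (hc : interior U ∪ interior V = univ) (hc' : interior U' ∪ interior V' = univ)
    (hUi : ∀ j, IsIso (singularHomology.map R M (subsetRestrict f hU) j))
    (hVi : ∀ j, IsIso (singularHomology.map R M (subsetRestrict f hV) j))
    (hUVi : ∀ j, IsIso (singularHomology.map R M (subsetRestrict f (hU.inter_inter hV)) j))
    (k : ℕ) : IsIso (singularHomology.map R M f (k + 1)) := by
  haveI := hUi (k + 1); haveI := hVi (k + 1); haveI := hUVi (k + 1)
  haveI := hUi k; haveI := hVi k; haveI := hUVi k
  exact isIso_singularHomology_map_succ_of_mayerVietoris_five R M f hU hV hc hc' k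

/-- **Pieces and intersection homology isomorphisms ⇒ homology isomorphism in all degrees**, for
path-connected `X`, `Y` (degree `0`: `singularHomology.isIso_map_zero_of_pathConnectedSpace`).
[cite: HatcherAT2002, §2.2 p. 150] -/
theorem isIso_singularHomology_map_of_forall_isIso [PathConnectedSpace X] [PathConnectedSpace Y]
    (f : C(X, Y)) {U V : Set X} {U' V' : Set Y} (hU : MapsTo f U U') (hV : MapsTo f V V')
    (hc : interior U ∪ interior V = univ) (hc' : interior U' ∪ interior V' = univ)
    (hUi : ∀ j, IsIso (singularHomology.map R M (subsetRestrict f hU) j))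
    (hVi : ∀ j, IsIso (singularHomology.map R M (subsetRestrict f hV) j))
    (hUVi : ∀ j, IsIso (singularHomology.map R M (subsetRestrict f (hU.inter_inter hV)) j))
    (k : ℕ) : IsIso (singularHomology.map R M f k) := by
  cases k with
  | zero => exact singularHomology.isIso_map_zero_of_pathConnectedSpace R M f
  | succ k => exact isIso_singularHomology_map_succ_of_forall_isIso R M f hU hV hc hc' hUi hVi hUVi k

end Comparison

end Literature.AlgebraicTopology.SingularHomology

end
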